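import Literature.AnabelianGeometry.EtaleTheta.Discharge.Sec5SeedsOfThm44
import Literature.AnabelianGeometry.EtaleTheta.Discharge.Sec5AodotCharacteristicOfTemperoid

/-!
# [EtTh] §5, Thm. 5.7 anchor: «`A_N^bs` is characteristic» ⟹ `Ψ(A_N)^bs ≅ A_N^bs` — the binder `hbs` of the seeds producer from the Prop. 2.4-class clause (p.329 / PDF p.103)

Mochizuki, *The étale theta function …*, Publ. RIMS **45** (2009): proof of Thm. 5.6, p.329 (PDF p.103) l.4–5 "let `S₂ ∈ Ob(C)` be …
such that `S₂^bs` is 'characteristic' [i.e., its isomorphism class is preserved by arbitrary self-equivalences of `D`]", l.10–12 "hence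
isomorphic to `S₁` [cf. our assumption that `S₁^bs ≅ S₂^bs` is characteristic …]"; §5 p.322–323 (PDF pp.96–97) "this `A_⊙^bs` is
'characteristic' … [cf. Propositions 2.4, 2.6]"; [FrdI] Thm. 3.4 (v) (the 1-compatible self-equivalence `Ψ^bs`)
[cite: MochizukiEtTh2009, Thm 5.6 proof p.329 (PDF p.103); §5 p.322–323 (PDF pp.96–97)]; [cite: MochizukiSemiAnbd2006, Rmk 3.1.2 p.33–34].

PROOF-ONLY (0 definitions, no new named fact).  abc-iut cell, layer L2, ROWS #14 R232 sequel #3 (abc-iut-w5-d245 gen 4).  The binder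
`hbs : Ψ(A_N)^bs ≅ A_N^bs` of the seeds producers (`exists_seeds_div_eq_refl_model`, `…_ofConnectedTemperoidData(_of_thm44)`, p445769 /
p446085) PRODUCED over `B^temp(Π^tp_X)⁰` from the topological-group clause «`N_{A_N} = Ker(Π^tp_X ↠ Gal(A_N^bs))` is characteristic in
`Π^tp_X`» (abc-iut-w4-d008's currency `IsTopCharacteristic`, the [EtTh] Prop. 2.4-class input; for `A_⊙^bs = Ÿ` it IS the Prop. 2.4
`Ÿ`-clause, `hchar_mkOfThetaSettingYdd_iff_isTopCharacteristic`): `Ψ^bs := psiBase Ψ` ([FrdI] Thm. 3.4 (v) for the model over the slim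
FSM-type base — abc-iut-L1-d4's `psiBase` / `psiBase_isEquivalence` / `psiBaseSquare` with the [FrdI] Thm. 3.4 (iii) clauses of
abc-iut-L1-t13 and Thm. 5.2 (ii)), `Ψ(A_N)^bs ≅ Ψ^bs(A_N^bs)` by the square, and `Ψ^bs(A_N^bs) ≅ A_N^bs` by abc-iut-w4-d008's
`nonempty_iso_of_connectedPart_equivalence_of_isTopCharacteristic` ([SemiAnbd] Prop. 3.2 / Rmk. 3.1.2: a self-equivalence of
`B^temp(Π)⁰` is `B^temp(γ)⁰`, which fixes `Π/N` when `N` is characteristic).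
NET: at the genuine data the residual of {seeds `αs βs`, `hdivcap₁`, `hdivcup₁`} is {`hcharN` (Prop. 2.4-class clause for `A_N^bs`),
`hdivA` (Prop. 5.3 (vi) read at `A_N`, `β`-free)} given the knit's `h44`/`h3` and `Φ` non-dilating
(`exists_seeds_hdivcapcup_ofConnectedTemperoidData_of_isTopCharacteristic`).
HONEST FRAMING: kernel-checked implications about the §5 data; `hcharN` is a hypothesis ON THE CHOSEN ROOT (print's "such that … is
characteristic"), asserted nowhere; typed ≠ discharged; no side taken on [IUTchIII] Cor. 3.12.
-/

noncomputable section

namespace Literature.AnabelianGeometry.EtaleTheta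

open CategoryTheory Opposite Literature.AlgebraicGeometry.Frobenioids Literature.AnabelianGeometry.SemiGraphs
  Literature.AnabelianGeometry.SemiGraphs.GaloisObjects FrobenioidCyclotomicRigidity

universe u₀ v₀ w

namespace BiKummerSetting

section Connected

variable {K : Type u₀} [Field K] {X : SemiGraphs.TemperedArithmeticGroup.{u₀} K} {D₀ : Type u₀} [Category.{v₀} D₀]
  {V : FrdIMonoidStub.{w}} {T₀ : RealifiedDivisorMonoids (D₀ := D₀) V}
  {VD : FrdICatStub.{u₀ + 1, u₀, w} (ConnectedPart (BTemp X.Pi))}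
  {tf : TemperedFrobenioid T₀ (ConnectedPart (BTemp X.Pi)) VD} {hZ : tf.monoidType = MonoidType.Z}
  {hP : ∀ A : (ConnectedPart (BTemp X.Pi))ᵒᵖ, IsPerfect (tf.Φ.carrier A)}
  {NH : Subgroup (Field.absoluteGaloisGroup K) → tf.category → ℕ+ → Prop} {A₀ : tf.category}
  {hA₀ : PreFrobenioid.IsFrobeniusTrivial tf.toElem A₀} {hA₀' : SemiGraphs.IsGaloisObj A₀.base.obj}
  (h : ModelFrobenioid.Hypotheses tf.divisorMonoid tf.ratFnFunctor)

include h in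
/-- **«`A^bs` characteristic» ⟹ `Ψ(A)^bs ≅ A^bs` for every self-equivalence `Ψ` of the tempered Frobenioid over `B^temp(Π^tp_X)⁰`**
(`Φ` non-dilating; `A` Galois): with `Ψ^bs := psiBase Ψ` ([FrdI] Thm. 3.4 (v): base `B^temp(Π^tp_X)⁰` slim and of FSM-type, Thm. 3.4
(iii) clauses, Thm. 5.2 (ii)), `Ψ(A)^bs ≅ Ψ^bs(A^bs)` by the square `psiBaseSquare`, and `Ψ^bs(A^bs) ≅ A^bs` since `N_A` is characteristic
([SemiAnbd] Rmk. 3.1.2, abc-iut-w4-d008's `nonempty_iso_of_connectedPart_equivalence_of_isTopCharacteristic`).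
[cite: MochizukiEtTh2009, Thm 5.6 proof p.329 (PDF p.103); §5 p.322–323 (PDF pp.96–97)] -/
theorem nonempty_baseIso_map_of_isTopCharacteristic (hnd : IsNonDilatingOn tf.divisorMonoid)
    (Ψ : (mkOfConnectedTemperoid X tf hZ hP NH A₀ hA₀ hA₀').C ≌ (mkOfConnectedTemperoid X tf hZ hP NH A₀ hA₀ hA₀').C)
    (A : (mkOfConnectedTemperoid X tf hZ hP NH A₀ hA₀ hA₀').C) (hA : SemiGraphs.IsGaloisObj A.base.obj)
    (hc : IsTopCharacteristic X.Pi (galoisSurjOf X.isTempered A.base.obj hA).ker) :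
    Nonempty ((PreFrobenioid.baseFunctor (mkOfConnectedTemperoid X tf hZ hP NH A₀ hA₀ hA₀').F).obj (Ψ.functor.obj A) ≅
      (PreFrobenioid.baseFunctor (mkOfConnectedTemperoid X tf hZ hP NH A₀ hA₀ hA₀').F).obj A) := by
  haveI := X.secondCountableTopology
  have hD : IsOfFSMType (ConnectedPart (BTemp X.Pi)) := QuasiTemperoid.BTempConnected.connectedPart_isOfFSMType
  have hslim : IsSlim (ConnectedPart (BTemp X.Pi)) := SemiGraphs.TemperedArithmeticGroup.isSlim_connectedPart X
  have hN : ∃ B : (mkOfConnectedTemperoid X tf hZ hP NH A₀ hA₀ hA₀').C,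
      ¬ (PreFrobenioidData.ofModel tf.divisorMonoid tf.ratFnFunctor tf.divBNatTrans).IsGroupLikeObj B :=
    tf.exists_not_isGroupLikeObj_ofModel
  have hF : PreFrobenioid.IsFrobenioid (mkOfConnectedTemperoid X tf hZ hP NH A₀ hA₀ hA₀').F :=
    ModelFrobenioid.isFrobenioid (DivB := tf.divBNatTrans) h.isMonoidOn h.isDivisorial h.isMonoidOn_rat
      h.isGroupLike_rat h.isGraphConnected h.isTotallyEpimorphic
  -- [FrdI] Thm. 3.4 (iii) clauses for `Ψ` and `Ψ⁻¹` (abc-iut-L1-t13)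
  have hq := ModelFrobenioid.data_isOfQuasiIsotropicType (DivB := tf.divBNatTrans) h
  have hnd' : (ModelFrobenioid.data tf.divisorMonoid tf.ratFnFunctor tf.divBNatTrans).IsNonDilatingOn :=
    (ModelFrobenioid.data_isNonDilatingOn_iff tf.divisorMonoid tf.ratFnFunctor tf.divBNatTrans).mpr hnd
  obtain ⟨hlist, -⟩ := FrdI.thm34iii_morphisms_of_isOfFSMType hF hF hq hq hD hD hnd' hnd' Ψ hN hN
  obtain ⟨hlist', -⟩ := FrdI.thm34iii_morphisms_of_isOfFSMType hF hF hq hq hD hD hnd' hnd' Ψ.symm hN hN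
  -- [FrdI] Thm. 3.4 (v), first sentence (slim base): `Ψ`, `Ψ⁻¹` preserve base-equivalent pairs; pre-steps ↦ base-isos
  have hbeF : ∀ ⦃A B : (mkOfConnectedTemperoid X tf hZ hP NH A₀ hA₀ hA₀').C⦄ (φ ψ : A ⟶ B),
      PreFrobenioid.BaseEquivalent (mkOfConnectedTemperoid X tf hZ hP NH A₀ hA₀ hA₀').F φ ψ →
      PreFrobenioid.BaseEquivalent (mkOfConnectedTemperoid X tf hZ hP NH A₀ hA₀ hA₀').F (Ψ.functor.map φ) (Ψ.functor.map ψ) :=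
    fun A B φ ψ hφψ => PreFrobenioid.baseEquivalent_map_of_isSlim hF hF Ψ hslim (fun X Y f hf => hlist.2.2.1 f hf) hφψ
  have hbeF' : ∀ ⦃A B : (mkOfConnectedTemperoid X tf hZ hP NH A₀ hA₀ hA₀').C⦄ (φ ψ : A ⟶ B),
      PreFrobenioid.BaseEquivalent (mkOfConnectedTemperoid X tf hZ hP NH A₀ hA₀ hA₀').F φ ψ →
      PreFrobenioid.BaseEquivalent (mkOfConnectedTemperoid X tf hZ hP NH A₀ hA₀ hA₀').F (Ψ.inverse.map φ) (Ψ.inverse.map ψ) :=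
    fun A B φ ψ hφψ => PreFrobenioid.baseEquivalent_map_of_isSlim hF hF Ψ.symm hslim (fun X Y f hf => hlist'.2.2.1 f hf) hφψ
  have hbi := ThetaFrobenioid.isIso_base_map_of_isPreStep_model (DivB := tf.divBNatTrans) Ψ h hD
  have hbi' : ∀ ⦃Y A : (mkOfConnectedTemperoid X tf hZ hP NH A₀ hA₀ hA₀').C⦄ (a : Y ⟶ A),
      PreFrobenioid.IsPreStep (mkOfConnectedTemperoid X tf hZ hP NH A₀ hA₀ hA₀').F a →
      IsIso (PreFrobenioid.Base (mkOfConnectedTemperoid X tf hZ hP NH A₀ hA₀ hA₀').F (Ψ.inverse.map a)) :=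
    ThetaFrobenioid.isIso_base_map_of_isPreStep_model (DivB := tf.divBNatTrans) Ψ.symm h hD
  -- `Ψ^bs` is an equivalence ([FrdI] Thm. 3.4 (v), abc-iut-L1-d4)
  let Θ : ConnectedPart (BTemp X.Pi) ≌ ConnectedPart (BTemp X.Pi) :=
    @Functor.asEquivalence _ _ _ _ (PreFrobenioid.psiBase hF Ψ.functor hbi hbeF)
      (PreFrobenioid.psiBase_isEquivalence hF hF Ψ hbi hbeF hbi' hbeF')
  -- `Ψ^bs(A^bs) ≅ A^bs` since `N_A` is characteristic; `Ψ(A)^bs ≅ Ψ^bs(A^bs)` by the square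
  obtain ⟨i⟩ := nonempty_iso_of_connectedPart_equivalence_of_isTopCharacteristic X.isTempered Θ A.base hA hc
  exact ⟨(PreFrobenioid.psiBaseSquare hF Ψ.functor hbi hbeF).app A ≪≫ i⟩

end Connected

end BiKummerSetting

/-! ### The seeds producer with `hbs` DISCHARGED from the characteristic clause -/

namespace ThetaFrobenioid

variable {K : Type u₀} [Field K] {X : SemiGraphs.TemperedArithmeticGroup.{u₀} K} {D₀ : Type u₀} [Category.{v₀} D₀]
  {V : FrdIMonoidStub.{w}} {T₀ : RealifiedDivisorMonoids (D₀ := D₀) V}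
  {VD : FrdICatStub.{u₀ + 1, u₀, w} (ConnectedPart (BTemp X.Pi))}
  {tf : TemperedFrobenioid T₀ (ConnectedPart (BTemp X.Pi)) VD} {hZ : tf.monoidType = MonoidType.Z}
  {hP : ∀ A : (ConnectedPart (BTemp X.Pi))ᵒᵖ, IsPerfect (tf.Φ.carrier A)}
  {NH : Subgroup (Field.absoluteGaloisGroup K) → tf.category → ℕ+ → Prop} {A₀ : tf.category}
  {hA₀ : PreFrobenioid.IsFrobeniusTrivial tf.toElem A₀} {hA₀' : SemiGraphs.IsGaloisObj A₀.base.obj}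
  {lv N : ℕ+} {T : ThetaEnvData.{max u₀ w} N}
  {pullFrac : ∀ {A A' : (BiKummerSetting.mkOfConnectedTemperoid X tf hZ hP NH A₀ hA₀ hA₀').C} (_ : A' ⟶ A),
    (BiKummerSetting.mkOfConnectedTemperoid X tf hZ hP NH A₀ hA₀ hA₀').biratUnits A →
      (BiKummerSetting.mkOfConnectedTemperoid X tf hZ hP NH A₀ hA₀ hA₀').biratUnits A'}
  {θ : (BiKummerSetting.mkOfConnectedTemperoid X tf hZ hP NH A₀ hA₀ hA₀').biratUnits
    (BiKummerSetting.mkOfConnectedTemperoid X tf hZ hP NH A₀ hA₀ hA₀').Aodot}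
  {Bl : (BiKummerSetting.mkOfConnectedTemperoid X tf hZ hP NH A₀ hA₀ hA₀').C}
  {Pl : (BiKummerSetting.mkOfConnectedTemperoid X tf hZ hP NH A₀ hA₀ hA₀').FractionPair θ Bl}
  {Rl : (BiKummerSetting.mkOfConnectedTemperoid X tf hZ hP NH A₀ hA₀ hA₀').NthRoot θ Pl lv pullFrac}
  (h : ModelFrobenioid.Hypotheses tf.divisorMonoid tf.ratFnFunctor)
  (Q : FrobenioidTheta.ThetaSubquotientStub.{w} (ConnectedPart (BTemp X.Pi))) (odd_l : Odd (lv : ℕ))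
  (R : (BiKummerSetting.mkOfConnectedTemperoid X tf hZ hP NH A₀ hA₀ hA₀').NthRoot Rl.root Rl.pair N pullFrac)
  (ιX : T.PiX ≃ₜ* X.Pi) (K' : Type w) [Field K'] (constEmb : K'ˣ →* tf.biratUnitsModel R.BN)
  (constEmb_injective : Function.Injective constEmb)
  (hinvc : ∀ g : Aut R.AN.base,
    pull tf.divisorMonoid g.hom (ModelFrobenioid.div R.pair.num) = ModelFrobenioid.div R.pair.num)
  (hinvp : ∀ y : T.PiX, y ∈ T.PiYdd →
    pull tf.divisorMonoid ((BiKummerSetting.mkOfConnectedTemperoid X tf hZ hP NH A₀ hA₀ hA₀').galoisSurj R.AN.base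
      R.αData.isGalois (ιX y)).hom (ModelFrobenioid.div R.pair.den) = ModelFrobenioid.div R.pair.den)
  (h44 : BiKummerSetting.Thm44Hyp (BiKummerSetting.mkOfConnectedTemperoid X tf hZ hP NH A₀ hA₀ hA₀')
    (BiKummerSetting.mkOfConnectedTemperoid X tf hZ hP NH A₀ hA₀ hA₀'))

/-- **The seeds `αs, βs` and `hdivcap₁`/`hdivcup₁` of the anchored capstone from `h3`, the CHARACTERISTIC CLAUSE for `A_N^bs` and
`hdivA`** — `exists_seeds_hdivcapcup_ofConnectedTemperoidData_of_thm44` with `hbs` DISCHARGED by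
`BiKummerSetting.nonempty_baseIso_map_of_isTopCharacteristic` (`Φ` non-dilating; `A_N` is Galois: the field `NthRoot.αData.isGalois`).
Residual: `hcharN` (the Prop. 2.4-class clause «`Ker(Π^tp_X ↠ Gal(A_N^bs))` characteristic», a hypothesis on the CHOSEN root) and
`hdivA` (Prop. 5.3 (vi) read at `A_N`).  [cite: MochizukiEtTh2009, Thm 5.6 proof p.329 (PDF p.103); Thm 5.10 (i) p.333 (PDF p.107)] -/
theorem exists_seeds_hdivcapcup_ofConnectedTemperoidData_of_isTopCharacteristic (hnd : IsNonDilatingOn tf.divisorMonoid)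
    (h3 : h44.PreservesFrobeniusStructure)
    (hcharN : IsTopCharacteristic X.Pi (galoisSurjOf X.isTempered R.AN.base.obj R.αData.isGalois).ker)
    (hdivA : ∀ α : h44.Ψ.functor.obj (ofConnectedTemperoidData h Q odd_l R ιX K' constEmb constEmb_injective hinvc hinvp).AN ≅
        (ofConnectedTemperoidData h Q odd_l R ιX K' constEmb constEmb_injective hinvc hinvp).AN,
      ∃ ε : Aut (ofConnectedTemperoidData h Q odd_l R ιX K' constEmb constEmb_injective hinvc hinvp).AN,
        (ofConnectedTemperoidData h Q odd_l R ιX K' constEmb constEmb_injective hinvc hinvp).pre.div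
            (α.inv ≫ h44.Ψ.functor.map (ofConnectedTemperoidData h Q odd_l R ιX K' constEmb constEmb_injective hinvc hinvp).sCap) =
          (ofConnectedTemperoidData h Q odd_l R ιX K' constEmb constEmb_injective hinvc hinvp).pre.div
            (ε.hom ≫ (ofConnectedTemperoidData h Q odd_l R ιX K' constEmb constEmb_injective hinvc hinvp).sCap) ∧
        (ofConnectedTemperoidData h Q odd_l R ιX K' constEmb constEmb_injective hinvc hinvp).pre.div
            (α.inv ≫ h44.Ψ.functor.map (ofConnectedTemperoidData h Q odd_l R ιX K' constEmb constEmb_injective hinvc hinvp).sCup) =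
          (ofConnectedTemperoidData h Q odd_l R ιX K' constEmb constEmb_injective hinvc hinvp).pre.div
            (ε.hom ≫ (ofConnectedTemperoidData h Q odd_l R ιX K' constEmb constEmb_injective hinvc hinvp).sCup)) :
    ∃ (αs : h44.Ψ.functor.obj (ofConnectedTemperoidData h Q odd_l R ιX K' constEmb constEmb_injective hinvc hinvp).AN ≅
        (ofConnectedTemperoidData h Q odd_l R ιX K' constEmb constEmb_injective hinvc hinvp).AN)
      (βs : h44.Ψ.functor.obj (ofConnectedTemperoidData h Q odd_l R ιX K' constEmb constEmb_injective hinvc hinvp).BN ≅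
        (ofConnectedTemperoidData h Q odd_l R ιX K' constEmb constEmb_injective hinvc hinvp).BN),
      αs.inv ≫ h44.Ψ.functor.map (ofConnectedTemperoidData h Q odd_l R ιX K' constEmb constEmb_injective hinvc hinvp).sCap ≫ βs.hom =
        (ofConnectedTemperoidData h Q odd_l R ιX K' constEmb constEmb_injective hinvc hinvp).sCap ∧
      (ofConnectedTemperoidData h Q odd_l R ιX K' constEmb constEmb_injective hinvc hinvp).pre.div
          (αs.inv ≫ h44.Ψ.functor.map (ofConnectedTemperoidData h Q odd_l R ιX K' constEmb constEmb_injective hinvc hinvp).sCap ≫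
            βs.hom) =
        (ofConnectedTemperoidData h Q odd_l R ιX K' constEmb constEmb_injective hinvc hinvp).pre.div
          (ofConnectedTemperoidData h Q odd_l R ιX K' constEmb constEmb_injective hinvc hinvp).sCap ∧
      (ofConnectedTemperoidData h Q odd_l R ιX K' constEmb constEmb_injective hinvc hinvp).pre.div
          (αs.inv ≫ h44.Ψ.functor.map (ofConnectedTemperoidData h Q odd_l R ιX K' constEmb constEmb_injective hinvc hinvp).sCup ≫
            βs.hom) =
        (ofConnectedTemperoidData h Q odd_l R ιX K' constEmb constEmb_injective hinvc hinvp).pre.div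
          (ofConnectedTemperoidData h Q odd_l R ιX K' constEmb constEmb_injective hinvc hinvp).sCup :=
  exists_seeds_hdivcapcup_ofConnectedTemperoidData_of_thm44 h Q odd_l R ιX K' constEmb constEmb_injective hinvc hinvp h44 h3
    (BiKummerSetting.nonempty_baseIso_map_of_isTopCharacteristic h hnd h44.Ψ R.AN R.αData.isGalois hcharN) hdivA

end ThetaFrobenioid

end Literature.AnabelianGeometry.EtaleTheta

end
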